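import Summits.HodgeConjecture.HodgeConjecture.Theorems.PadicSemiregularLiftHodgeFermatVarietiesStubClaimLevelPull
import Literature.AlgebraicGeometry.HodgeTheory.FermatLevelMap
import Literature.AlgebraicGeometry.HodgeTheory.AlgebraicClassesPullback
import HarnessLib

/-!
# `stub_claimLevelPull` modulo Fulton Cor. 19.2 (b) and the finite-quotient transfer — line `cancel-by-any-claim-lattice`, crux `HodgeFermatVarieties` (stmt-HodgeConjecture-1334)

Helper file (`--supports stmt-HodgeConjecture-1334`) for the stub `stub_claimLevelPull` (S2↑) of the
skeleton of line `cancel-by-any-claim-lattice`: claim_m(α') ⟹ claim_{km}(k • α') along the level map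
`π : X²ʳ_{km} → X²ʳₘ`, `[xᵢ] ↦ [xᵢᵏ]` (Shioda–Katsura 1979 §1; Aoki 1987 p. 387 and Cor. 2-3; da Silva,
arXiv:2101.04739 Thm. 2.8).

The landed conditional `stub_claimLevelPull_of_levelMap` (`…StubClaimLevelPull`) takes four inputs:
(M1) a morphism `π : fermatHypersurface (2r) (km) ⟶ fermatHypersurface (2r) m`, (M2) its points
formula, (M3) `Flat π.left`, (M4) the transfer for the finite quotient `X_m = X_{km}/K`,
`K = ker (μ_{km}^{2r+2} → μₘ^{2r+2})`. Since then (M1) + (M2) LANDED unconditionally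
(`fermatLevelMap`, `exists_rep_hypersurfacePoint_map_fermatLevelMap`, file `FermatLevelMap`), and
(M3) is only used to know that `π^*` preserves `Nʳ H²ʳ` — which is the named fact
`fulton1998_map_mem_algebraicClasses` (Fulton, *Intersection Theory*, Cor. 19.2 (b): pull-back along
ANY morphism of smooth projective varieties preserves algebraic classes; file
`AlgebraicClassesPullback`). PROVED here:

* `stub_claimLevelPull_of_transfer` — **S2↑ from Fulton Cor. 19.2 (b) and the transfer (M4) for the
  level map `fermatLevelMap`**, (M4) kept as the explicit hypothesis: every class of
  `H²ʳ(X²ʳ_{km}(ℂ); ℂ)` fixed by `K = {a ∈ μ_{km}^{2r+2} | aᵏ = 1}` lies in the range of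
  `fermatLevelMap^*`. The proof re-runs that of `stub_claimLevelPull_of_levelMap` with
  `π := fermatLevelMap (2r) hk hm`.

REMAINING (not in the tree, 2026-08-17): (M4), i.e. `H*(X_{km}(ℂ); ℂ)^K = π^* H*(X_m(ℂ); ℂ)` for the
NON-FREE finite quotient (Grothendieck, Tôhoku 9 (1957) Thm. 5.3.1; Bredon, *Sheaf Theory* II.19.2);
the tree's `FiniteDeckTransfer*` treats free actions (covering maps) only. See the sequel file
`…StubClaimLevelPullFacts` for (M4) from the printed theorem.

## References

* [ShiodaKatsura1979] T. Shioda, T. Katsura, On Fermat varieties, Tôhoku Math. J. 31 (1979), §1.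
* [Aoki1987] N. Aoki, Some new algebraic cycles on Fermat varieties, J. Math. Soc. Japan 39 (1987),
  §1 p. 387 and Cor. 2-3.
* [daSilva2021HodgeFermat] G. da Silva Jr., arXiv:2101.04739, Thm. 2.8.
* [Fulton1998] W. Fulton, Intersection Theory, 2nd ed. (1998), §19.2 Cor. 19.2 (b).
-/

set_option linter.dupNamespace false

noncomputable section

open CategoryTheory AlgebraicGeometry Finset
open Literature.AlgebraicGeometry Literature.AlgebraicGeometry.Motives
open Literature.AlgebraicGeometry.HodgeTheory Literature.AlgebraicGeometry.HodgeTheory.FermatCharacter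
open Literature.AlgebraicTopology.SingularHomology

namespace Summit.HodgeConjecture.HodgeConjecture.Theorems.CancelByAnyClaimLattice

/-! ### S2↑ `stub_claimLevelPull` from Fulton Cor. 19.2 (b) and the transfer -/

section LevelPullTransfer

/-- **S2↑ `stub_claimLevelPull` modulo Fulton Cor. 19.2 (b) and the finite-quotient transfer
(registered conditional form).** GRANTED (F) the named fact `fulton1998_map_mem_algebraicClasses`
(pull-back along a morphism of smooth projective complex varieties maps `Nᵖ H²ᵖ` into `Nᵖ H²ᵖ`) and
(M4) the transfer for the level map `π = fermatLevelMap (2r) hk hm : X²ʳ_{km} ⟶ X²ʳₘ`, `[xᵢ] ↦ [xᵢᵏ]`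
(every class of `H²ʳ(X²ʳ_{km}(ℂ); ℂ)` fixed by `K = {a ∈ μ_{km}^{2r+2} | aᵏ = 1}` is in the range of
`π^*`), claim pulls back along the level map: claim_m(α') ⟹ claim_{km}(k • α') for every `k ≥ 1`
and zero-free `α'` — the registered statement of `stub_claimLevelPull`. Proof (that of
`stub_claimLevelPull_of_levelMap` with `π := fermatLevelMap`, whose points formula
`exists_rep_hypersurfacePoint_map_fermatLevelMap` is (M2)): for `c ∈ V_{km}(k • α')` and `a ∈ K`,
`g_a^* c = χ_{k•α'}(a) c = c` (`fermatCharacter_levelRaise_eq_one`), so `c = π^* c₀` by (M4);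
`c₀ = Σ_γ proj_γ c₀` (`sum_fermatProjector`) with `π^* proj_γ c₀ ∈ V_{km}(k • γ)`
(`map_mem_fermatEigenspace_of_levelMap`), and the projector onto `V_{km}(k • α')` (`γ ↦ k • γ`
injective, `levelRaise_injective`) leaves `c = π^*(proj_{α'} c₀)`; `proj_{α'} c₀ ∈ V_m(α') ⊆ Nʳ H²ʳ(X_m)`
by claim_m(α'), and `π^*` preserves `Nʳ H²ʳ` by (F) (both standard models are smooth projective,
`isSmoothProjective_fermatHypersurface`). Degenerate cases `r = 0` (`FermatCharacter.claim_zero`),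
`m = 0` (`claim_level_zero`).
[cite: ShiodaKatsura1979, §1] [cite: Aoki1987, §1 p. 387 and Cor. 2-3 (p. 388)]
[cite: daSilva2021HodgeFermat, Thm. 2.8] [cite: Fulton1998, §19.2 Cor. 19.2 (b)] -/
theorem stub_claimLevelPull_of_transfer :
    fulton1998_map_mem_algebraicClasses →
    (∀ (m k r : ℕ) (hm : 0 < m) (hk : 0 < k)
      (c : complexBetti (fermatHypersurface (2 * r) (k * m)) (2 * r)),
      (∀ (a : Fin (2 * r + 2) → ℂˣ) (ha : a ∈ fermatGroup (2 * r) (k * m)), a ^ k = 1 →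
        singularCohomology.map ℂ ℂ (diagonalMap (fermatPolynomial ℂ (2 * r) (k * m))
          (fermatGroup_le_diagonalStabilizer (k * m) ha)) (2 * r) c = c) →
      c ∈ LinearMap.range (complexBetti.map (fermatLevelMap (2 * r) hk hm) (2 * r)).hom) →
    ∀ (m k r : ℕ) (α' : Fin (2 * r + 2) → ZMod m), 0 < k → (∀ i, α' i ≠ 0) →
      FermatCharacter.Claim m r α' →
        FermatCharacter.Claim (k * m) r (fun i => ((k * (α' i).val : ℕ) : ZMod (k * m))) := by
  intro hF hT m k r α' hk _hα' hC
  rcases Nat.eq_zero_or_pos r with rfl | hr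
  · exact FermatCharacter.claim_zero (k * m) _
  rcases Nat.eq_zero_or_pos m with rfl | hm
  · exact claim_level_zero r _
  haveI : NeZero m := ⟨hm.ne'⟩
  have hkm : 0 < k * m := Nat.mul_pos hk hm
  haveI : NeZero (k * m) := ⟨hkm.ne'⟩
  set π := fermatLevelMap (2 * r) hk hm
  have h2 := exists_rep_hypersurfacePoint_map_fermatLevelMap (n := 2 * r) hk hm
  intro c hc
  -- Step 1: `c` is `K`-invariant, hence `c = π^* c₀`
  obtain ⟨c₀, hc₀⟩ : c ∈ LinearMap.range (complexBetti.map π (2 * r)).hom := by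
    refine hT m k r hm hk c fun a ha hak ↦ ?_
    rw [(mem_fermatEigenspace_iff.mp hc) ⟨a, ha⟩, fermatCharacter_levelRaise_eq_one hk α' ha hak,
      Units.val_one, one_smul]
  -- Step 2/3: `c = π^* (proj_{α'} c₀)`
  have hsum : c = ∑ γ : Fin (2 * r + 2) → ZMod m,
      complexBetti.map π (2 * r) (fermatProjector m γ (2 * r) c₀) := by
    rw [← map_sum, sum_fermatProjector]
    exact hc₀.symm
  have key : c = complexBetti.map π (2 * r) (fermatProjector m α' (2 * r) c₀) := by
    rw [← fermatProjector_apply_of_mem hc]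
    conv_lhs => rw [hsum, map_sum]
    rw [Finset.sum_eq_single α']
    · exact fermatProjector_apply_of_mem
        (map_mem_fermatEigenspace_of_levelMap hk π h2 (fermatProjector_mem α' c₀))
    · intro γ _ hγ
      exact fermatProjector_apply_of_mem_of_ne
        (map_mem_fermatEigenspace_of_levelMap hk π h2 (fermatProjector_mem γ c₀))
        fun h ↦ hγ (levelRaise_injective hk h)
    · exact fun h ↦ absurd (Finset.mem_univ α') h
  -- Step 4: pull-back of an algebraic class along a morphism of smooth projective varieties (F)
  rw [key]
  exact hF π (isSmoothProjective_fermatHypersurface (by omega) hm)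
    (isSmoothProjective_fermatHypersurface (by omega) hkm) r _ (hC (fermatProjector_mem α' c₀))

end LevelPullTransfer

end Summit.HodgeConjecture.HodgeConjecture.Theorems.CancelByAnyClaimLattice

end
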